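import Summits.BirchSwinnertonDyer.BirchSwinnertonDyer.Theorems.CumulativeHeegnerLeopoldtCumulativeHeegnerInclusionAtThreeLayerControl
import Summits.BirchSwinnertonDyer.Rank1Residual.X11b.AnticyclotomicInfinitePlaces
import Summits.BirchSwinnertonDyer.BirchSwinnertonDyer.Theorems.UniversalToricDescentResidualSelmerLocal
import HarnessLib

/-!
# Crux K1 `CumulativeHeegnerInclusionAtThree` (stmt-BirchSwinnertonDyer-24198) / crux A (stmt-26896): the
# port [P-ctl] — anticyclotomic CONTROL AT EVERY LAYER `K_n`, Selmer formulation, II: elliptic curves over a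
# totally complex `K` (any `p`, any `ℤ_p`-extension with topological generator `γ`, any `𝔭`, `Σ`, `n`)

Width seat bsd-line-chl-k1-p1-w8 (`--supports stmt-BirchSwinnertonDyer-24198`). THEOREMS ONLY (no definition,
no named fact, no `sorry`); ROUTE-INDEPENDENT. Sequel of `…CumulativeHeegnerInclusionAtThreeLayerControl` (I,
generic discrete modules, p648123): here `M = E[p^∞]` for an elliptic curve `E/K`, and the local descent is
DISCHARGED wherever the tree can: at the infinite places (totally complex `K`), at the places split completely
in `K_∞` (I §5), and at the GOOD places `v ∤ p` AT EVERY LAYER (§2) — so that only the BAD finitely decomposed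
`v ∤ p` outside `Σ` remain (Tamagawa-type kernels, Greenberg's `ker r_{n,v}`; the `C_n` of the (LT) layer data).

* §1 totally complex `K`: the INFINITE conditions descend to `K_n` — indeed are vacuous
  (`decompInf w = ⊥ ≤ ker κ`): `infConditions_descend_layer_of_isTotallyComplex`.
* §2 GOOD places at layer `n` (Greenberg's Lemma 3.3, good case, one level up): the away condition at a good
  `v ∤ p` descends from `K_∞` to `K_n` for every conjugate of every class
  (`resOfLe_layer_mem_awayKer_iff_of_hasGoodReductionAt`, `awayCondition_descends_layer_of_hasGoodReductionAt`),
  from the tree's `H¹(Ω ⊓ D_v, E[p^∞]) ↪ H¹(I_v, E[p^∞])` for every OPEN `Ω ⊇ I_v`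
  (`UniversalToricDescentResidualSelmerLocal.resOfLe_inertia_injective_of_isOpen`, with `Ω = Gal(\bar K/K_n)`:
  open, and `⊇ I_v` because `ℤ_p`-extensions are unramified outside `p`).
* §3 packaging: `s_n` lands in `Sel[ω_n] = ker (conj_{γ^{pⁿ}} − 1) = ker ((conj_γ)^{pⁿ} − 1)`
  (`resOfLe_layer_mem_endInvariants_pow`, `…_pow'`); `s_n` is INJECTIVE when `E(K_∞)[p^∞] = 0`
  (`resOfLe_layer_injective_of_fixedPoints_eq_bot`); `s_n` hits every `conj_{γ^{pⁿ}}`-fixed class modulo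
  `E(\bar K)[p^∞]^{D_𝔭 ⊓ ker κ} = 0` and away descent at the BAD `v ∉ Σ`, `v ∤ p` not split completely in `K_∞`
  (`exists_mem_selmerOver_layer_resOfLe_eq_of_bad_descent`); **`layerControl_of_bad_descent`**; and with NO
  descent input when `Σ ⊇ {bad v ∤ p}`: **`layerControl_of_bad_subset`** —
  `Sel_𝔭^Σ(K_n, E[p^∞]) ≅ Sel_𝔭^Σ(K_∞, E[p^∞])[ω_n]` at EVERY layer `n` (the layer-`n` form of X11b's
  `controlMap_bijective_of_bad_subset`, which is the case `n = 0`).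

Nothing about the local kernels at the bad finitely decomposed `v ∉ Σ` is asserted (hypothesis `hS`). Crux A
(26896) and K1 (24198) stay OPEN; BSD is not proved by any of this; no summit statement is proved by this seat.

References: [GreenbergLNM1716] §3 Lemmas 3.1–3.3 and p. 90; [GreenbergVatsal2000] §2 p. 17;
[JetchevSkinnerWan2017] §3.3 (shape only); [Castella2018] Def. 2.2 (arXiv:1704.06608 p. 5);
[SerreGaloisCohomology1997] I.§2.6 (b), I.§3.4; [Washington1997] Prop. 13.2.
-/


set_option linter.dupNamespace false
set_option autoImplicit false

noncomputable section

open scoped Classical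

namespace Summit.BirchSwinnertonDyer.BirchSwinnertonDyer.Theorems.CumulativeHeegnerInclusionAtThreeLayerControlCurve

open NumberField IsDedekindDomain Field
open Literature.NumberTheory.EllipticCurves Literature.NumberTheory.EllipticCurves.GreenbergSelmer
open Literature.NumberTheory.GaloisRepresentations
open Summit.BirchSwinnertonDyer.Rank1Residual.X11b Summit.BirchSwinnertonDyer.Rank1Residual.X11b.AcSelmer
open Summit.BirchSwinnertonDyer.BirchSwinnertonDyer.Theorems.CumulativeHeegnerInclusionAtThreeLayerControl

/-! ## §1 Totally complex `K`: the infinite conditions are vacuous at every layer -/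

section TotallyComplex

variable {K : Type} [Field K] [NumberField K] {p : ℕ} [Fact p.Prime] (κ : ZpExtension K p)
  {M : Type} [AddCommGroup M] [DistribMulAction (absoluteGaloisGroup K) M]
  [TopologicalSpace M] [DiscreteTopology M]

/-- **The INFINITE conditions descend to `K_n` (indeed are vacuous) for totally complex `K`** (every infinite
place complex, e.g. `K` imaginary quadratic; then every `K_n` is totally complex too): `decompInf w = ⊥ ≤ ker κ`
(tree `decompInf_eq_bot_of_isComplex`). Layer-`n` form of `AcSelmer.infConditions_descend_of_isTotallyComplex`.
[cite: GreenbergLNM1716, §3 p. 87 (archimedean primes split completely)] -/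
theorem infConditions_descend_layer_of_isTotallyComplex [IsTotallyComplex K] (n : ℕ)
    {𝔭 : HeightOneSpectrum (𝓞 K)} {S : Set (HeightOneSpectrum (𝓞 K))}
    {c : subgroupH1 (κ.layerSubgroup n) M}
    (hc : resOfLe M (κ.kerSubgroup_le_layerSubgroup n) c ∈ selmerOver κ.kerSubgroup M p 𝔭 S)
    (w : InfinitePlace K) (σ : absoluteGaloisGroup K) :
    conjH1 (κ.layerSubgroup n) M σ c ∈ infKer (κ.layerSubgroup n) M w := by
  have hD : decompInf w ≤ κ.kerSubgroup := by
    rw [decompInf_eq_bot_of_isComplex (IsTotallyComplex.isComplex w)]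
    exact bot_le
  have e : resOfLe M (κ.kerSubgroup_le_layerSubgroup n) (conjH1 (κ.layerSubgroup n) M σ c) =
      conjH1 κ.kerSubgroup M σ (resOfLe M (κ.kerSubgroup_le_layerSubgroup n) c) := by
    rw [← AddMonoidHom.comp_apply,
      resOfLe_comp_conjH1_holds (M := M) (κ.kerSubgroup_le_layerSubgroup n) σ, AddMonoidHom.comp_apply]
  have h := ((mem_selmerOver_iff _).mp (conjH1_mem_selmerOver σ hc)).2.1 w 1
  rw [conjH1_one_holds, AddMonoidHom.id_apply, ← e] at h
  exact (resOfLe_mem_infKer_iff_of_decompInf_le_of_le (κ.kerSubgroup_le_layerSubgroup n) w hD _).mp h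

end TotallyComplex

/-! ## §2 Good places at layer `n`: the away condition descends from `K_∞` to `K_n` -/

section GoodPlaces

variable {K : Type} [Field K] [NumberField K] (E : WeierstrassCurve K) [E.IsElliptic]
  (p : ℕ) [Fact p.Prime] (κ : ZpExtension K p)

/-- `I_v ≤ Gal(\bar K/K_n)` for the chosen prime `𝔓₀` above `v ∤ p` (`I_{𝔓₀} ≤ ker κ ≤ κ⁻¹(pⁿℤ_p)`:
`ℤ_p`-extensions are unramified outside `p`, tree `ZpExtension.inertia_le_kerSubgroup_holds`).
[cite: Washington1997, Prop. 13.2] -/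
theorem inertia_le_layerSubgroup {v : HeightOneSpectrum (𝓞 K)} (hpv : (p : 𝓞 K) ∉ v.asIdeal) (n : ℕ) :
    (adicCompletionPrime K v).inertia (absoluteGaloisGroup K) ≤ κ.layerSubgroup n :=
  (ZpExtension.inertia_le_kerSubgroup_holds K p κ hpv (adicCompletionPrime_mem_primesAbove K v)).trans
    (κ.kerSubgroup_le_layerSubgroup n)

/-- **The AWAY condition DESCENDS to `K_n` at a good `v ∤ p`** (any `ℤ_p`-extension `κ`, any `n`): for
`c ∈ H¹(K_n, E[p^∞]) = H¹(κ⁻¹(pⁿℤ_p), E[p^∞])`, `res_{K_n→K_∞} c` is locally trivial at the chosen place above `v`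
over `K_∞` IFF `c` is locally trivial at the chosen place above `v` over `K_n`. (→: both restrict to the same
class on `I_v ≤ ker κ ⊓ D_v ≤ κ⁻¹(pⁿℤ_p) ⊓ D_v`, namely `0`, and
`H¹(κ⁻¹(pⁿℤ_p) ⊓ D_v, E[p^∞]) ↪ H¹(I_v, E[p^∞])` (tree `resOfLe_inertia_injective_of_isOpen`: Greenberg's Lemma
3.3, good case, for the OPEN subgroup `Gal(\bar K/K_n) ⊇ I_v`); ←: functoriality.) The bottom layer is the tree's
`resOfLe_mem_awayKer_kerSubgroup_iff_of_hasGoodReductionAt`. [cite: GreenbergLNM1716, §3 Lemma 3.3 (p. 87)]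
[cite: GreenbergVatsal2000, §2 p. 17] -/
theorem resOfLe_layer_mem_awayKer_iff_of_hasGoodReductionAt {v : HeightOneSpectrum (𝓞 K)}
    (hpv : (p : 𝓞 K) ∉ v.asIdeal) (hv : E.HasGoodReductionAt v) (n : ℕ)
    (c : E.subgroupH1 p (κ.layerSubgroup n)) :
    resOfLe (E.geomPrimaryTorsion p) (κ.kerSubgroup_le_layerSubgroup n) c ∈
        awayKer κ.kerSubgroup (E.geomPrimaryTorsion p) v ↔
      c ∈ awayKer (κ.layerSubgroup n) (E.geomPrimaryTorsion p) v := by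
  refine ⟨fun hc ↦ ?_, resOfLe_mem_awayKer (κ.kerSubgroup_le_layerSubgroup n) v⟩
  rw [awayKer, AddMonoidHom.mem_ker] at hc ⊢
  have h𝔓₀ := adicCompletionPrime_mem_primesAbove K v
  -- both sides restrict to `0` on `I_v`
  have hIK : (adicCompletionPrime K v).inertia (absoluteGaloisGroup K) ≤ κ.kerSubgroup ⊓ decomp v :=
    le_inf (ZpExtension.inertia_le_kerSubgroup_holds K p κ hpv h𝔓₀) (inertia_adicCompletionPrime_le_decomp v)
  have hIL : (adicCompletionPrime K v).inertia (absoluteGaloisGroup K) ≤ κ.layerSubgroup n ⊓ decomp v :=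
    le_inf (inertia_le_layerSubgroup p κ hpv n) (inertia_adicCompletionPrime_le_decomp v)
  have e2 : resOfLe (E.geomPrimaryTorsion p) hIK (resOfLe (E.geomPrimaryTorsion p)
      (inf_le_left : κ.kerSubgroup ⊓ decomp v ≤ κ.kerSubgroup)
        (resOfLe (E.geomPrimaryTorsion p) (κ.kerSubgroup_le_layerSubgroup n) c)) =
      resOfLe (E.geomPrimaryTorsion p)
        ((hIK.trans (inf_le_left : κ.kerSubgroup ⊓ decomp v ≤ κ.kerSubgroup)).trans
          (κ.kerSubgroup_le_layerSubgroup n)) c := by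
    rw [← AddMonoidHom.comp_apply, ← AddMonoidHom.comp_apply, resOfLe_comp_holds, resOfLe_comp_holds]
  rw [hc, map_zero] at e2
  have e1 : resOfLe (E.geomPrimaryTorsion p) hIL (resOfLe (E.geomPrimaryTorsion p)
      (inf_le_left : κ.layerSubgroup n ⊓ decomp v ≤ κ.layerSubgroup n) c) =
      resOfLe (E.geomPrimaryTorsion p)
        (hIL.trans (inf_le_left : κ.layerSubgroup n ⊓ decomp v ≤ κ.layerSubgroup n)) c := by
    rw [← AddMonoidHom.comp_apply, resOfLe_comp_holds]
  have h0 : resOfLe (E.geomPrimaryTorsion p) hIL (resOfLe (E.geomPrimaryTorsion p)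
      (inf_le_left : κ.layerSubgroup n ⊓ decomp v ≤ κ.layerSubgroup n) c) = 0 := by
    rw [e1]; exact e2.symm
  exact (injective_iff_map_eq_zero _).mp
    (UniversalToricDescentResidualSelmerLocal.resOfLe_inertia_injective_of_isOpen E p hpv hv
      (κ.isOpen_layerSubgroup n) (inertia_le_layerSubgroup p κ hpv n)) _ h0

/-- **Away descent at the good places, for every conjugate** — the hypothesis `hS` of
`layerControl_of_away_descent` at a good `v ∤ p`: if `res_{K_n→K_∞} c` lies in Castella's Selmer group
`Sel_𝔭^Σ(K_∞, E[p^∞])` (any `𝔭`, `Σ`), then for every `σ ∈ Γ_K` the conjugate `conj_σ c` is locally trivial at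
the chosen place above `v` over `K_n` (`v ∉ Σ`) — i.e. `c` is locally trivial at EVERY place of `K_n` above `v`.
[cite: GreenbergLNM1716, §3 Lemma 3.3 (p. 87) and p. 90] -/
theorem awayCondition_descends_layer_of_hasGoodReductionAt {v : HeightOneSpectrum (𝓞 K)}
    (hpv : (p : 𝓞 K) ∉ v.asIdeal) (hv : E.HasGoodReductionAt v) (n : ℕ)
    {𝔭 : HeightOneSpectrum (𝓞 K)} {S : Set (HeightOneSpectrum (𝓞 K))} (hvS : v ∉ S)
    {c : E.subgroupH1 p (κ.layerSubgroup n)}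
    (hc : E.resOfLe p (κ.kerSubgroup_le_layerSubgroup n) c ∈ selmerAc E p κ 𝔭 S)
    (σ : absoluteGaloisGroup K) :
    E.conjH1 p (κ.layerSubgroup n) σ c ∈ awayKer (κ.layerSubgroup n) (E.geomPrimaryTorsion p) v := by
  have hpv' : ((p : ℕ) : 𝓞 K) ∉ v.asIdeal := hpv
  have e : E.resOfLe p (κ.kerSubgroup_le_layerSubgroup n) (E.conjH1 p (κ.layerSubgroup n) σ c) =
      E.conjH1 p κ.kerSubgroup σ (E.resOfLe p (κ.kerSubgroup_le_layerSubgroup n) c) := by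
    show resOfLe (E.geomPrimaryTorsion p) (κ.kerSubgroup_le_layerSubgroup n)
        (conjH1 (κ.layerSubgroup n) (E.geomPrimaryTorsion p) σ c) =
      conjH1 κ.kerSubgroup (E.geomPrimaryTorsion p) σ
        (resOfLe (E.geomPrimaryTorsion p) (κ.kerSubgroup_le_layerSubgroup n) c)
    rw [← AddMonoidHom.comp_apply,
      resOfLe_comp_conjH1_holds (M := E.geomPrimaryTorsion p) (κ.kerSubgroup_le_layerSubgroup n) σ,
      AddMonoidHom.comp_apply]
  have h := ((mem_selmerOver_iff _).mp (conjH1_mem_selmerAc σ hc)).1 v hpv' hvS 1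
  rw [conjH1_one_holds κ.kerSubgroup (E.geomPrimaryTorsion p), AddMonoidHom.id_apply, ← e] at h
  exact (resOfLe_layer_mem_awayKer_iff_of_hasGoodReductionAt E p κ hpv hv n _).mp h

end GoodPlaces

/-! ## §3 Elliptic curves: the layer-`n` control theorem modulo BAD-place descent -/

section Curve

variable {K : Type} [Field K] [NumberField K] {p : ℕ} [Fact p.Prime] (κ : ZpExtension K p)
  (W : WeierstrassCurve K) [W.IsElliptic] (𝔭 : HeightOneSpectrum (𝓞 K)) (S : Set (HeightOneSpectrum (𝓞 K)))

omit [W.IsElliptic] in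
/-- **`s_n` lands in `Sel_𝔭^Σ(K_∞, E[p^∞])^{γ^{pⁿ}}`**: for `c ∈ Sel_𝔭^Σ(K_n, E[p^∞])` the class `res_{K_n→K_∞} c`
lies in Castella's Selmer group over `K_∞` and in the invariants `ker (conj_{γ^{pⁿ}} − 1)` of the endomorphism
`conjSelmerAc … (γ^{pⁿ})` (EVERY `γ ∈ Γ_K`; for a topological generator these are the `Γ_n`-invariants, dual to
`X/ω_n X`, `ω_n = (1+T)^{pⁿ} − 1`). [cite: GreenbergLNM1716, §3 p. 85 (`s_n`)] -/
theorem resOfLe_layer_mem_endInvariants_pow (n : ℕ) (γ : absoluteGaloisGroup K)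
    {c : W.subgroupH1 p (κ.layerSubgroup n)}
    (hc : c ∈ selmerOver (κ.layerSubgroup n) (W.geomPrimaryTorsion p) p 𝔭 S) :
    (⟨W.resOfLe p (κ.kerSubgroup_le_layerSubgroup n) c, resOfLe_layer_mem_selmerOver κ n hc⟩ :
        selmerAc W p κ 𝔭 S) ∈
      IwasawaDual.endInvariants (conjSelmerAc W p κ 𝔭 S (γ ^ p ^ n) - 1) := by
  rw [IwasawaDual.mem_endInvariants_iff, IwasawaDual.End_sub_apply, AddMonoid.End.one_apply,
    sub_eq_zero]
  exact Subtype.ext (conjH1_pow_resOfLe_layer κ n γ c)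

omit [W.IsElliptic] in
/-- The same invariants, written with the `pⁿ`-th power of the endomorphism `conj_γ − 1 + 1`:
`ker ((conjSelmerAc γ)^{pⁿ} − 1)` (`coe_conjSelmerAc_pow_apply`) — the `Λ`-module form `Sel[ω_n]`,
`ω_n = (1+T)^{pⁿ} − 1`, `1 + T ↦ conj_γ`. [cite: GreenbergLNM1716, §1 p. 60 and §3 p. 85] -/
theorem resOfLe_layer_mem_endInvariants_pow' (n : ℕ) (γ : absoluteGaloisGroup K)
    {c : W.subgroupH1 p (κ.layerSubgroup n)}
    (hc : c ∈ selmerOver (κ.layerSubgroup n) (W.geomPrimaryTorsion p) p 𝔭 S) :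
    (⟨W.resOfLe p (κ.kerSubgroup_le_layerSubgroup n) c, resOfLe_layer_mem_selmerOver κ n hc⟩ :
        selmerAc W p κ 𝔭 S) ∈
      IwasawaDual.endInvariants ((conjSelmerAc W p κ 𝔭 S γ) ^ p ^ n - 1) := by
  rw [IwasawaDual.mem_endInvariants_iff, IwasawaDual.End_sub_apply, AddMonoid.End.one_apply,
    sub_eq_zero]
  exact Subtype.ext (by rw [coe_conjSelmerAc_pow_apply]; exact conjH1_pow_resOfLe_layer κ n γ c)

omit [NumberField K] [W.IsElliptic] in
/-- **`s_n` is INJECTIVE when `E(K_∞)[p^∞] = 0`**, at every layer `n`, for every elliptic `E/K`, every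
`ℤ_p`-extension `κ`, every `𝔭`, `Σ`. [cite: GreenbergLNM1716, §3 Lemma 3.1 (p. 86)] -/
theorem resOfLe_layer_injective_of_fixedPoints_eq_bot (n : ℕ)
    (hB : FixedPoints.addSubgroup κ.kerSubgroup (W.geomPrimaryTorsion p) = ⊥) :
    Function.Injective (W.resOfLe p (κ.kerSubgroup_le_layerSubgroup n)) :=
  resOfLe_layer_injective_of_fixedPoints κ n (W.continuous_smul_geomPrimaryTorsion p) fun m hm ↦ by
    have : m ∈ FixedPoints.addSubgroup κ.kerSubgroup (W.geomPrimaryTorsion p) := fun y ↦ hm y y.2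
    rwa [hB, AddSubgroup.mem_bot] at this

/-- **`s_n` is SURJECTIVE modulo BAD-place descent, for totally complex `K`** (any elliptic `E/K`, any `p`,
any `ℤ_p`-extension `κ` with topological generator `γ`, any `𝔭`, `Σ`, `n`): assume
`E(\bar K)[p^∞]^{D_𝔭 ⊓ ker κ} = 0` and that for every class `c ∈ H¹(K_n, E[p^∞])` whose restriction lies in
`Sel_𝔭^Σ(K_∞, E[p^∞])` the away conditions hold at the finite `v ∉ Σ`, `v ∤ p` of BAD reduction NOT split
completely in `K_∞` (at the split ones, the good ones (§2) and the infinite places (§1) they are automatic).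
Then every class of `Sel_𝔭^Σ(K_∞, E[p^∞])` fixed by `conj_{γ^{pⁿ}}` is `res_{K_n→K_∞}` of a class of
`Sel_𝔭^Σ(K_n, E[p^∞])`.
[cite: GreenbergLNM1716, §3 p. 90 (Lemmas 3.1, 3.2, 3.5 ⟹ Thm. 1.2)] [cite: JetchevSkinnerWan2017, §3.3 (control; shape only)] -/
theorem exists_mem_selmerOver_layer_resOfLe_eq_of_bad_descent [IsTotallyComplex K] (n : ℕ)
    {γ : absoluteGaloisGroup K} (hγ : κ.IsTopGenerator γ)
    (h0 : FixedPoints.addSubgroup ↥(decomp 𝔭 ⊓ κ.kerSubgroup) (W.geomPrimaryTorsion p) = ⊥)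
    (hS : ∀ c : W.subgroupH1 p (κ.layerSubgroup n),
      W.resOfLe p (κ.kerSubgroup_le_layerSubgroup n) c ∈ selmerAc W p κ 𝔭 S →
        ∀ v : HeightOneSpectrum (𝓞 K), ((p : ℕ) : 𝓞 K) ∉ v.asIdeal → v ∉ S →
          ¬ decomp v ≤ κ.kerSubgroup → ¬ W.HasGoodReductionAt v → ∀ σ : absoluteGaloisGroup K,
            W.conjH1 p (κ.layerSubgroup n) σ c ∈ awayKer (κ.layerSubgroup n) (W.geomPrimaryTorsion p) v)
    {x : W.subgroupH1 p κ.kerSubgroup} (hx : x ∈ selmerAc W p κ 𝔭 S)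
    (hfix : W.conjH1 p κ.kerSubgroup (γ ^ p ^ n) x = x) :
    ∃ c ∈ selmerOver (κ.layerSubgroup n) (W.geomPrimaryTorsion p) p 𝔭 S,
      W.resOfLe p (κ.kerSubgroup_le_layerSubgroup n) c = x := by
  have h0' : ∀ m : W.geomPrimaryTorsion p, (∀ y ∈ decomp 𝔭 ⊓ κ.kerSubgroup, y • m = m) → m = 0 :=
    fun m hm ↦ by
      have : m ∈ FixedPoints.addSubgroup ↥(decomp 𝔭 ⊓ κ.kerSubgroup) (W.geomPrimaryTorsion p) :=
        fun y ↦ hm y y.2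
      rwa [h0, AddSubgroup.mem_bot] at this
  refine exists_mem_selmerOver_layer_resOfLe_eq_of_local_descent κ n hγ 𝔭 S
    (W.continuous_smul_geomPrimaryTorsion p) (fun m ↦ by
      obtain ⟨k, hk⟩ := m.2
      exact ⟨k, Subtype.ext (by rw [AddSubgroupClass.coe_nsmul, hk, ZeroMemClass.coe_zero])⟩)
    h0' (fun c hc v hv hvS σ ↦ ?_)
    (fun c hc w σ ↦ infConditions_descend_layer_of_isTotallyComplex κ n hc w σ) hx hfix
  by_cases hD : decomp v ≤ κ.kerSubgroup
  · exact awayCondition_descends_layer_of_decomp_le κ n hD hv hvS hc σ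
  · by_cases hgood : W.HasGoodReductionAt v
    · exact awayCondition_descends_layer_of_hasGoodReductionAt W p κ hv hgood n hvS hc σ
    · exact hS c hc v hv hvS hD hgood σ

/-- **Layer-`n` CONTROL modulo BAD-place descent (totally complex `K`)** — the layer-`n` form of X11b's
`controlMap_bijective_of_away_descent`: if `E(K_∞)[p^∞] = 0`, `E(\bar K)[p^∞]^{D_𝔭 ⊓ ker κ} = 0` and the away
conditions descend to `K_n` at the finite `v ∉ Σ`, `v ∤ p` of bad reduction not split completely in `K_∞`, then
`s_n : Sel_𝔭^Σ(K_n, E[p^∞]) → Sel_𝔭^Σ(K_∞, E[p^∞])^{γ^{pⁿ}}` (restriction) is injective AND hits every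
`conj_{γ^{pⁿ}}`-fixed class — `Sel_𝔭^Σ(K_n, E[p^∞]) ≅ Sel_𝔭^Σ(K_∞, E[p^∞])[ω_n]` at EVERY layer `n`.
Nothing about the local kernels at the finitely decomposed `v` is asserted (they are the hypothesis `hS`).
[cite: GreenbergLNM1716, §3 p. 90 (Thm. 1.2 from Lemmas 3.1, 3.2, 3.5)] [cite: JetchevSkinnerWan2017, §3.3 (control; shape only)] -/
theorem layerControl_of_bad_descent [IsTotallyComplex K] (n : ℕ)
    {γ : absoluteGaloisGroup K} (hγ : κ.IsTopGenerator γ)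
    (hB : FixedPoints.addSubgroup κ.kerSubgroup (W.geomPrimaryTorsion p) = ⊥)
    (h0 : FixedPoints.addSubgroup ↥(decomp 𝔭 ⊓ κ.kerSubgroup) (W.geomPrimaryTorsion p) = ⊥)
    (hS : ∀ c : W.subgroupH1 p (κ.layerSubgroup n),
      W.resOfLe p (κ.kerSubgroup_le_layerSubgroup n) c ∈ selmerAc W p κ 𝔭 S →
        ∀ v : HeightOneSpectrum (𝓞 K), ((p : ℕ) : 𝓞 K) ∉ v.asIdeal → v ∉ S →
          ¬ decomp v ≤ κ.kerSubgroup → ¬ W.HasGoodReductionAt v → ∀ σ : absoluteGaloisGroup K,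
            W.conjH1 p (κ.layerSubgroup n) σ c ∈ awayKer (κ.layerSubgroup n) (W.geomPrimaryTorsion p) v) :
    Function.Injective (W.resOfLe p (κ.kerSubgroup_le_layerSubgroup n)) ∧
      ∀ x ∈ selmerAc W p κ 𝔭 S, W.conjH1 p κ.kerSubgroup (γ ^ p ^ n) x = x →
        ∃! c : W.subgroupH1 p (κ.layerSubgroup n),
          c ∈ selmerOver (κ.layerSubgroup n) (W.geomPrimaryTorsion p) p 𝔭 S ∧
            W.resOfLe p (κ.kerSubgroup_le_layerSubgroup n) c = x := by
  have hinj := resOfLe_layer_injective_of_fixedPoints_eq_bot κ W n hB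
  refine ⟨hinj, fun x hx hfix ↦ ?_⟩
  obtain ⟨c, hc, hcx⟩ :=
    exists_mem_selmerOver_layer_resOfLe_eq_of_bad_descent κ W 𝔭 S n hγ h0 hS hx hfix
  exact ⟨c, ⟨hc, hcx⟩, fun c' hc' ↦ hinj (hc'.2.trans hcx.symm)⟩

/-- **Layer-`n` CONTROL with NO descent input, `Σ ⊇ {bad v ∤ p}` (totally complex `K`)** — the layer-`n` form
of X11b's `controlMap_bijective_of_bad_subset`: if `E(K_∞)[p^∞] = 0`, `E(\bar K)[p^∞]^{D_𝔭 ⊓ ker κ} = 0` and `Σ`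
contains every finite `v ∤ p` of bad reduction, then at EVERY layer `n` the restriction
`s_n : Sel_𝔭^Σ(K_n, E[p^∞]) → Sel_𝔭^Σ(K_∞, E[p^∞])[ω_n]` is injective and hits every `conj_{γ^{pⁿ}}`-fixed class:
**`Sel_𝔭^Σ(K_n, E[p^∞]) ≅ Sel_𝔭^Σ(K_∞, E[p^∞])^{Γ_n}` for all `n`** — exact control along the whole tower, no
residual input (Lemma 3.1: `E(K_∞)[p^∞] = 0`; Lemma 3.2: tree; Lemma 3.3: good places §2, nothing to check at
`v ∈ Σ` and at the relaxed `v ∣ p`; the strict place: `E(K_{∞,w})[p^∞] = 0`; `K_w = ℂ` at infinity).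
[cite: GreenbergLNM1716, §3 Lemmas 3.1–3.3 and p. 90 (Thm. 1.2, every layer)] [cite: JetchevSkinnerWan2017, §3.3 (shape only)] -/
theorem layerControl_of_bad_subset [IsTotallyComplex K] (n : ℕ)
    {γ : absoluteGaloisGroup K} (hγ : κ.IsTopGenerator γ)
    (hB : FixedPoints.addSubgroup κ.kerSubgroup (W.geomPrimaryTorsion p) = ⊥)
    (h0 : FixedPoints.addSubgroup ↥(decomp 𝔭 ⊓ κ.kerSubgroup) (W.geomPrimaryTorsion p) = ⊥)
    (hbad : ∀ v : HeightOneSpectrum (𝓞 K), (p : 𝓞 K) ∉ v.asIdeal → ¬ W.HasGoodReductionAt v → v ∈ S) :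
    Function.Injective (W.resOfLe p (κ.kerSubgroup_le_layerSubgroup n)) ∧
      ∀ x ∈ selmerAc W p κ 𝔭 S, W.conjH1 p κ.kerSubgroup (γ ^ p ^ n) x = x →
        ∃! c : W.subgroupH1 p (κ.layerSubgroup n),
          c ∈ selmerOver (κ.layerSubgroup n) (W.geomPrimaryTorsion p) p 𝔭 S ∧
            W.resOfLe p (κ.kerSubgroup_le_layerSubgroup n) c = x :=
  layerControl_of_bad_descent κ W 𝔭 S n hγ hB h0
    fun _ _ v hv hvS _ hvbad _ ↦ (hvS (hbad v hv hvbad)).elim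

end Curve

end Summit.BirchSwinnertonDyer.BirchSwinnertonDyer.Theorems.CumulativeHeegnerInclusionAtThreeLayerControlCurve

end
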